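import Mathlib
import HarnessLib
import Summits.NavierStokesRegularity.NavierStokesRegularity.Theorems.UnthreadedRigidityDoorUnthreadedRigidityThreadingJetsDefs

/-!
# Route `UnthreadedRigidityDoor`, item `UnthreadedRigidity` (W2, stmt-NavierStokesRegularity-27585) — THREADING JETS, SPLIT OF THE SLICE LAW:
# the two halves (F2) «ORDER-TWO LAW» / (F3) «VIRIAL LEMMA» of `OrderTwoSliceLaw`, and its GENERIC form (LINE g11-1 «VIRIAL HORN»)

Definition file (seat ns-crc-p1 g8; director-ns dss_146 (1): `orderTwoSliceLaw_holds` is a two-hand item — crc-p2 g8 (A), crc-p1 g8 (B); typed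
split posted by crc-p2 g8 2026-08-29T07:40:58Z, corrected by crc-p1 g8 07:45Z for the CARD's residual R1), `--supports stmt-NavierStokesRegularity-27585
--as helper`.  All objects are those of `…VirialHornDefs` (p695782) and `…ThreadingJetsDefs` (p704398); `u₀ := sepShellL H Y x₀`.

* `OrderTwoLawSlice` — (A), the (F2) ORDER-TWO LAW, POINTWISE (crc-p2's text verbatim): the formal second jet of the separable shell is
  `c₂(x₀ + y) = K(|y|) · (α(|y|)² {Y,|∇Y|²}(y) − {Y, y·∇p₀}(y))` for ANY smooth pressure slice `p₀` (a pure identity; no Poisson equation, no decay).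
* `VirialLemmaSlice` — (B′), the (F3) VIRIAL LEMMA with the `K`-FREE premise `α²{Y,|∇Y|²} ≡ {Y, y·∇p₀}` for the DECAYING solution `p₀` of the
  slice pressure Poisson equation: then `(∫₀^∞ r^{2l−3}α²)·{Y,|∇Y|²} ≡ 0` (CARD §2: every multipole coefficient `e_L` of `y·∇p₀` satisfies
  `r^{L−1}e_L = (r^L b_L)′`, so the `A`-weighted radial integral of the premise is `a·∫r^{2l−3}α² = 0`).  The premise is `K`-free ON PURPOSE: the
  typed (B) of 07:40:58Z had premise `K·Ψ ≡ 0`, from which `Ψ ≡ 0` follows only where `K ≠ 0` — the CARD's residual R1 (profiles with a plateau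
  `K ≡ 0` on an interval, e.g. `H ≡ 1` near the origin, are virial-admissible); the division by `K` is moved into the glue, under an explicit
  genericity hypothesis.
* `OrderTwoSliceLawGeneric` — `OrderTwoSliceLaw` (p704398) with ONE extra hypothesis: `K = vortAmpL l H` does not vanish on any open sub-interval
  of `(0, ∞)` (`∀ a b, 0 < a → a < b → ∃ r ∈ Ioo a b, vortAmpL l H r ≠ 0`).  GLUE (`…ThreadingJetsSplit.lean`):
  `OrderTwoLawSlice → VirialLemmaSlice → OrderTwoSliceLawGeneric`.  In a WINDOW the extra hypothesis is free (slices are real-analytic, so `H_t` is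
  analytic on `(0,∞)` and `K_t` either has isolated zeros or vanishes identically, in which case the slice is irrotational and null) — the M-side
  `virialWindowSilence_of_genericSliceLaw` is filed separately; for the one-sided SLICE bridge V the genericity is an honest residual of the line
  (R1) unless the rung is restated for generic profiles.

WHAT THIS IS NOT: no NS-regularity statement is touched; `UnthreadedRigidity` (27585), W2 and NS regularity stay OPEN; these are the typed halves of
one L-identity of a RUNG line; nobody here claims them.  [cite: MajdaBertozziCUP2002, §1.1 (vector identities)]
-/

-- the summit and its single sub-problem share the name (CONVENTIONS §1)
set_option linter.dupNamespace false

namespace Summit.NavierStokesRegularity.NavierStokesRegularity.Theorems.UnthreadedRigidity.ThreadingJets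

open scoped Topology RealInnerProductSpace Laplacian
open Filter Set
open Literature.Analysis.FluidPDE
open Summit.NavierStokesRegularity.NavierStokesRegularity.Theorems.UnthreadedRigidity.ProfileHorn (E3)
open Summit.NavierStokesRegularity.NavierStokesRegularity.Theorems.UnthreadedRigidity.VirialHorn
  (IsSolidHarmonic VirialAdmissible sepShellL virialMoment angForm pbr vortAmpL strainAmpL)

/-- (A) «ORDER-TWO LAW, POINTWISE» (the (F2) half of `OrderTwoSliceLaw`; crc-p2 g8's typed text of 2026-08-29T07:40:58Z VERBATIM): for a solid
harmonic `Y` of degree `l ≥ 1`, a virial-admissible profile `H`, the separable shell `u₀ = sepShellL H Y x₀` (smooth, divergence free) and ANY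
smooth pressure slice `p₀`, the formal second jet is `c₂(x₀ + y) = K(|y|)·(α(|y|)²{Y,|∇Y|²}(y) − {Y, y·∇p₀}(y))`.  A pure identity between explicit
fields (VIRIAL HORN card §1, exact symbolic check kit j323443 PART 1). -/
def OrderTwoLawSlice : Prop :=
  ∀ (l : ℕ) (x₀ : E3) (Y : E3 → ℝ) (H : ℝ → ℝ) (p₀ : E3 → ℝ),
    1 ≤ l → IsSolidHarmonic l Y → VirialAdmissible l H →
    ContDiff ℝ (⊤ : ℕ∞) (sepShellL H Y x₀) →
    Literature.Analysis.FluidPDE.VectorCalculus.IsDivFree (sepShellL H Y x₀) →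
    ContDiff ℝ (⊤ : ℕ∞) p₀ →
    ∀ y : E3, fluxJetTwo (sepShellL H Y x₀) p₀ x₀ (x₀ + y) =
      vortAmpL l H ‖y‖ * (strainAmpL l H ‖y‖ ^ 2 * angForm Y y - pbr Y (fun z => inner ℝ z (gradient p₀ (x₀ + z))) y)

/-- (B′) «VIRIAL LEMMA» (the (F3) half of `OrderTwoSliceLaw`, with the `K`-FREE premise — see the module docstring for why): for a solid harmonic `Y`
of degree `l ≥ 1`, a virial-admissible profile `H`, the separable shell `u₀ = sepShellL H Y x₀` (smooth, divergence free) and the smooth DECAYING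
solution `p₀` of the slice pressure Poisson equation `Δp₀ = −div((u₀·∇)u₀)`: if `α(|y|)²{Y,|∇Y|²}(y) = {Y, y·∇p₀}(y)` for all `y`, then
`(∫₀^∞ r^{2l−3}α²)·{Y,|∇Y|²} ≡ 0` (VIRIAL HORN card §2: the multipole coefficients of `y·∇p₀` are exact derivatives `r^{L−1}e_L = (r^L b_L)′`).
TRUE for every admissible profile; its Lean proof needs the finite spherical-harmonic structure of the explicit pressure (size XL in general degree,
explicit at `l = 2` through g7's `eulerPressure`/`aTwo`/`aFour`). -/
def VirialLemmaSlice : Prop :=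
  ∀ (l : ℕ) (x₀ : E3) (Y : E3 → ℝ) (H : ℝ → ℝ) (p₀ : E3 → ℝ),
    1 ≤ l → IsSolidHarmonic l Y → VirialAdmissible l H →
    ContDiff ℝ (⊤ : ℕ∞) (sepShellL H Y x₀) →
    Literature.Analysis.FluidPDE.VectorCalculus.IsDivFree (sepShellL H Y x₀) →
    ContDiff ℝ (⊤ : ℕ∞) p₀ →
    (∀ x : E3, (Δ p₀) x =
      -Literature.Analysis.FluidPDE.VectorCalculus.divergence (convect (sepShellL H Y x₀) (sepShellL H Y x₀)) x) →
    Tendsto p₀ (cocompact E3) (𝓝 0) →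
    (∀ y : E3, strainAmpL l H ‖y‖ ^ 2 * angForm Y y = pbr Y (fun z => inner ℝ z (gradient p₀ (x₀ + z))) y) →
    ∀ ξ : E3, virialMoment l H * angForm Y ξ = 0

/-- «ORDER-TWO SLICE LAW, GENERIC PROFILES»: `OrderTwoSliceLaw` (p704398) with the one extra hypothesis that the vorticity amplitude
`K = vortAmpL l H` does not vanish identically on any open sub-interval of `(0, ∞)` (no irrotational plateau shell) — the honest form of the
(F2)+(F3) argument (residual R1 of the VIRIAL HORN card made explicit).  Equals `OrderTwoSliceLaw` for real-analytic profiles; FREE in windows. -/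
def OrderTwoSliceLawGeneric : Prop :=
  ∀ (l : ℕ) (x₀ : E3) (Y : E3 → ℝ) (H : ℝ → ℝ) (p₀ : E3 → ℝ),
    1 ≤ l → IsSolidHarmonic l Y → VirialAdmissible l H →
    (∀ a b : ℝ, 0 < a → a < b → ∃ r ∈ Set.Ioo a b, vortAmpL l H r ≠ 0) →
    ContDiff ℝ (⊤ : ℕ∞) (sepShellL H Y x₀) →
    Literature.Analysis.FluidPDE.VectorCalculus.IsDivFree (sepShellL H Y x₀) →
    ContDiff ℝ (⊤ : ℕ∞) p₀ →
    (∀ x : E3, (Δ p₀) x =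
      -Literature.Analysis.FluidPDE.VectorCalculus.divergence (convect (sepShellL H Y x₀) (sepShellL H Y x₀)) x) →
    Tendsto p₀ (cocompact E3) (𝓝 0) →
    (∀ x : E3, fluxJetTwo (sepShellL H Y x₀) p₀ x₀ x = 0) →
    ∀ ξ : E3, virialMoment l H * angForm Y ξ = 0

/-- The typed slice law implies its generic form (the extra hypothesis is simply dropped). -/
theorem orderTwoSliceLawGeneric_of_sliceLaw (h : OrderTwoSliceLaw) : OrderTwoSliceLawGeneric :=
  fun l x₀ Y H p₀ hl hY hH _ hsm hdiv hp hpoi hdec hjet ξ => h l x₀ Y H p₀ hl hY hH hsm hdiv hp hpoi hdec hjet ξ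

end Summit.NavierStokesRegularity.NavierStokesRegularity.Theorems.UnthreadedRigidity.ThreadingJets
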